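import Summits.NavierStokesRegularity.NavierStokesRegularity.Theorems.EulerZoomLiouvillePowerGaugeEulerLiouvilleNeedleGradientGrowthTools
import Summits.NavierStokesRegularity.NavierStokesRegularity.Theorems.EulerZoomLiouvillePowerGaugeEulerLiouvilleNeedleThinCore
import Summits.NavierStokesRegularity.NavierStokesRegularity.Theorems.EulerZoomLiouvillePowerGaugeEulerLiouvilleSelfSimilarRadialBarrierLoc
import Summits.NavierStokesRegularity.NavierStokesRegularity.Theorems.EulerZoomLiouvillePowerGaugeEulerLiouvilleNeedleThinCoreMember
import HarnessLib

/-!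
# Crux E `PowerGaugeEulerLiouville` (stmt-NavierStokesRegularity-19832) — SUB-`(2+ρ)` GRADIENT GROWTH IS TAME
# (the first KILL by the needle log-capacity kernel)

Route №10 `EulerZoomLiouville` (NavierStokesRegularity), crux E, THE ONE STATEMENT `stub_selfSimilarC2Needle` (skeleton of
record `Cruxes/PowerGaugeEulerLiouville/Lines/birth.lean`, interim LEAD ns-typeII-p2 g10).  The registered needle is an exactly
self-similar class member with a `C²`, extremal, NON-TAME velocity profile `V` (`¬ IsTameC2Profile ρ V`: in particular for every
`κ < γ = 1/(2+ρ)` there are FAST-INFLOW points `⟪y, V y⟫ < −κ‖y‖²` beyond every radius, and `V` is not uniformly continuous).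

THIS FILE widens the tame class from «uniformly continuous» (bounded-type gradient) to «POLYNOMIAL GRADIENT GROWTH OF ANY DEGREE
`q < 2 + ρ`»: with the profile inputs (A) `∫⁻_{B_L} ‖V‖ₑ² ≤ c L^{1−2ρ}` and (E) `∫⁻ ‖∇V‖ₑ² ‖y‖^{ρ−1} ≤ C` of a `C¹` profile,

  `‖fderiv ℝ V y‖ ≤ K (1 + ‖y‖)^q` for all `y`, `q < 2 + ρ`  ⟹  for every `κ > 0`:  `−κ‖y‖² ≤ ⟪y, V y⟫` for all large `‖y‖`

(`radialBarrier_of_polyGradient`) — NO fast inflow at all far out, i.e. the radial-barrier disjunct of `IsTameC2Profile` for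
every `κ`; hence (member level, `selfSimilar_ae_eq_zero_of_polyGradient`, by name through
`Loc.selfSimilar_ae_eq_zero_of_radialInflowC2_profile`) such members are trivial.

MECHANISM (nsreg-p2 g31's needle-thinness kernel `NeedleThinness.needle_inradius_le_radial`, t36d, on a SHORT cylinder).  At a
fast point `y`, `‖y‖ = s`, the gradient bound `G(s) = K₊(1+2s)^{q₊} + 2κ` on `B(y, s/4)` and the mean-value inequality keep
`−⟪ŷ, V⟫ ≥ κ s/2` on the ball `B(y, r)`, `r = κ s/(2G(s))`; the coaxial cylinder of axis `ŷ`, base `s₀ = s − r/4`, height and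
radius `h = w = r/2` lies in that ball, so it is a `κ/2`-core in the kernel's sense.  With `R = 3s`, `𝓔 = (C₊+1)(3s)^{1−ρ}`,
`𝓐 = c(3s)^{1−2ρ} + 1` and `δ² = w² + 256𝓐/(πκ²s₀²r)` (the kernel's budget by construction; `(s₀+h)² + δ² ≤ 9s²` for large `s`
because `δ² − w² ≲ s^{q−2}`) the kernel gives `r/2 = w ≤ δ·exp(−πκ²s₀²r/(128𝓔)) ≤ 3s·exp(−B₀ s^{2+ρ−q₊})`, while
`r ≥ κ s^{1−q₊}/(2M)` — impossible for large `s` since `2 + ρ − q₊ > 0` (the exponential beats every power).  The threshold of the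
method is gradient growth `o(|y|^{2+ρ}/log|y|)`; the registered needle therefore has `sup_{B_L}‖∇V‖ ≳ L^{2+ρ}/log L`.

* `radialBarrier_of_polyGradient` — the profile theorem; `selfSimilar_ae_eq_zero_of_polyGradient` — the member corollary
  (tools — frame, short-cylinder geometry, mean-value step, `s^a e^{−b s^θ} → 0`, the real-variable bookkeeping — in file 1/2
  `…NeedleGradientGrowthTools.lean`; ball energy from the E-weight = ns-sfl-p1 g3's `NeedleThinCore.lintegral_ball_fderiv_sq_le_of_opWeight`;
  member inputs = `NeedleThinCore.selfSimilar_needle_inputs`).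

WHAT THIS IS NOT: not NS, not E — a new TAME SUB-STRATUM of THE ONE STATEMENT (polynomial gradient growth below degree `2+ρ`);
the needle with faster gradient growth stays OPEN; 19832 OPEN.  [folklore; length–area method via t36/t36d]
-/

noncomputable section

set_option linter.dupNamespace false

open MeasureTheory Set Filter Topology Metric Function Real
open scoped RealInnerProductSpace ENNReal NNReal

namespace Summit.NavierStokesRegularity.NavierStokesRegularity.Theorems.PowerGaugeEulerLiouville.NeedleGradientGrowth

open NeedleDiscChart NeedleThinness Literature.Analysis Literature.Analysis.FluidPDE

/-! ## The profile theorem -/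

/-- **SUB-`(2+ρ)` GRADIENT GROWTH IS TAME (profile level).**  Let `V : ℝ³ → ℝ³` be `C¹` with the A-growth
`∫⁻_{B_L} ‖V‖ₑ² ≤ c L^{1−2ρ}` (`L > 0`), the op-norm E-weight `∫⁻ ‖∇V(y)‖ₑ² ‖y‖^{ρ−1} dy ≤ C`, `0 < ρ < 1`, and POLYNOMIAL
GRADIENT GROWTH `‖∇V(y)‖ ≤ K (1 + ‖y‖)^q` with `q < 2 + ρ`.  Then for every `κ > 0` there is `R₁` with `−κ‖y‖² ≤ ⟪y, V y⟫`
whenever `‖y‖ ≥ R₁`: no fast radial inflow at all far out.  Proof: the needle-thinness kernel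
`NeedleThinness.needle_inradius_le_radial` on the short coaxial cylinder around a fast point (module docstring).
[folklore; length–area method, t36/t36d] -/
theorem radialBarrier_of_polyGradient {ρ : ℝ} (hρ : 0 < ρ) (hρ1 : ρ < 1) {c : ℝ≥0} {C : ℝ}
    {V : EuclideanSpace ℝ (Fin 3) → EuclideanSpace ℝ (Fin 3)} (hV : ContDiff ℝ 1 V)
    (hA : ∀ L : ℝ, 0 < L → ∫⁻ y in ball (0 : EuclideanSpace ℝ (Fin 3)) L, ‖V y‖ₑ ^ 2 ≤
      (c : ℝ≥0∞) * ENNReal.ofReal (L ^ (1 - 2 * ρ)))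
    (hE : ∫⁻ y, ‖fderiv ℝ V y‖ₑ ^ 2 * ENNReal.ofReal (‖y‖ ^ (ρ - 1)) ≤ ENNReal.ofReal C)
    {K q : ℝ} (hq : q < 2 + ρ) (hgrad : ∀ y, ‖fderiv ℝ V y‖ ≤ K * (1 + ‖y‖) ^ q) {κ : ℝ} (hκ : 0 < κ) :
    ∃ R₁ : ℝ, ∀ y : EuclideanSpace ℝ (Fin 3), R₁ ≤ ‖y‖ → -(κ * ‖y‖ ^ 2) ≤ ⟪y, V y⟫ := by
  -- constants
  obtain ⟨Kp, hKp⟩ : ∃ Kp : ℝ, Kp = max K 0 := ⟨_, rfl⟩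
  obtain ⟨q', hq'⟩ : ∃ q' : ℝ, q' = max q 0 := ⟨_, rfl⟩
  have hKp0 : 0 ≤ Kp := by rw [hKp]; exact le_max_right _ _
  have hKKp : K ≤ Kp := by rw [hKp]; exact le_max_left _ _
  have hq'0 : 0 ≤ q' := by rw [hq']; exact le_max_right _ _
  have hqq' : q ≤ q' := by rw [hq']; exact le_max_left _ _
  have hq'3 : q' ≤ 3 := by rw [hq']; exact max_le (by linarith) (by norm_num)
  have hθ0 : 0 < 2 + ρ - q' := by rw [hq']; have := max_lt hq (by linarith : (0 : ℝ) < 2 + ρ); linarith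
  obtain ⟨M, hM⟩ : ∃ M : ℝ, M = Kp * 3 ^ q' + 2 * κ := ⟨_, rfl⟩
  have hM0 : 0 < M := by rw [hM]; positivity
  obtain ⟨C₁, hC₁⟩ : ∃ C₁ : ℝ, C₁ = max C 0 + 1 := ⟨_, rfl⟩
  have hC₁0 : 0 < C₁ := by rw [hC₁]; positivity
  have hCC₁ : C ≤ C₁ := by rw [hC₁]; exact (le_max_left C 0).trans (le_add_of_nonneg_right zero_le_one)
  obtain ⟨B₀, hB₀⟩ : ∃ B₀ : ℝ, B₀ = 7 * π * κ ^ 3 / (12288 * M * C₁) := ⟨_, rfl⟩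
  have hB₀0 : 0 < B₀ := by rw [hB₀]; positivity
  obtain ⟨A₁, hA₁⟩ : ∃ A₁ : ℝ, A₁ = 8192 * (3 * (c : ℝ) + 1) * M / (49 * π * κ ^ 3) := ⟨_, rfl⟩
  -- the eventual inequality «exponential beats power»
  have hev : ∀ᶠ s : ℝ in atTop, 12 * M / κ * (s ^ q' * Real.exp (-(B₀ * s ^ (2 + ρ - q')))) < 1 := by
    have ht := (tendsto_rpow_mul_exp_neg_rpow (a := q') hB₀0 hθ0).const_mul (12 * M / κ)
    rw [mul_zero] at ht
    exact ht.eventually (Iio_mem_nhds one_pos)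
  obtain ⟨R₂, hR₂⟩ := eventually_atTop.1 hev
  refine ⟨max (max 1 A₁) R₂, fun y hy => ?_⟩
  -- a fast point `y`, `‖y‖ = s`
  by_contra hlt0
  have hlt1 := lt_of_not_ge hlt0
  obtain ⟨s, hs⟩ : ∃ s : ℝ, s = ‖y‖ := ⟨_, rfl⟩
  rw [← hs] at hy hlt1
  have hs1 : 1 ≤ s := ((le_max_left _ _).trans (le_max_left _ _)).trans hy
  have hsA₁ : A₁ ≤ s := ((le_max_right _ _).trans (le_max_left _ _)).trans hy
  have hev_s := hR₂ s ((le_max_right _ _).trans hy)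
  have hs0 : 0 < s := by linarith
  have hsne : s ≠ 0 := hs0.ne'
  have hsA : 8192 * (3 * (c : ℝ) + 1) * M ≤ 49 * π * κ ^ 3 * s := by
    rw [hA₁, div_le_iff₀ (by positivity)] at hsA₁
    linarith only [hsA₁]
  -- the unit vector and the frame
  obtain ⟨e, he_def⟩ : ∃ e : EuclideanSpace ℝ (Fin 3), e = s⁻¹ • y := ⟨_, rfl⟩
  have he : ‖e‖ = 1 := by
    rw [he_def, norm_smul, norm_inv, Real.norm_eq_abs, abs_of_pos hs0, ← hs, inv_mul_cancel₀ hsne]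
  have hye : y = s • e := by rw [he_def, smul_smul, mul_inv_cancel₀ hsne, one_smul]
  have hfast : ⟪e, V y⟫ < -(κ * s) := by
    have h1 : ⟪y, V y⟫ = s * ⟪e, V y⟫ := by rw [← real_inner_smul_left, ← hye]
    have h2 : s * ⟪e, V y⟫ < s * (-(κ * s)) := by
      have e1 : s * (-(κ * s)) = -(κ * s ^ 2) := by ring
      rw [← h1, e1]
      exact hlt1
    exact lt_of_mul_lt_mul_left h2 hs0.le
  obtain ⟨e₁, e₂, hon⟩ := exists_orthonormal_frame he
  -- the gradient envelope `G` on `B(y, s/4)` and the radius `r`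
  obtain ⟨G, hG_def⟩ : ∃ G : ℝ, G = Kp * (1 + 2 * s) ^ q' + 2 * κ := ⟨_, rfl⟩
  have hG2κ : 2 * κ ≤ G := by rw [hG_def]; exact le_add_of_nonneg_left (by positivity)
  have hG0 : 0 < G := by linarith
  have hGne : G ≠ 0 := hG0.ne'
  have hGM : G ≤ M * s ^ q' := by rw [hG_def, hM]; exact aux_envelope_le hs1 hKp0 hq'0 hκ.le
  have hsq0 : 0 < s ^ q' := Real.rpow_pos_of_pos hs0 _
  obtain ⟨r, hr_def⟩ : ∃ r : ℝ, r = κ * s / (2 * G) := ⟨_, rfl⟩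
  have hr0 : 0 < r := by rw [hr_def]; positivity
  have hGr : G * r = κ * s / 2 := by rw [hr_def]; field_simp
  have hrs : r ≤ s / 4 := by
    rw [hr_def, div_le_div_iff₀ (by positivity) (by norm_num : (0 : ℝ) < 4)]
    have := mul_le_mul_of_nonneg_left hG2κ hs0.le
    linarith only [this]
  have hκs : κ * s ≤ 2 * M * s ^ q' * r := by
    have h1 : κ * s = 2 * (G * r) := by rw [hGr]; ring
    have h2 : G * r ≤ M * s ^ q' * r := mul_le_mul_of_nonneg_right hGM hr0.le
    rw [h1]
    linarith only [h2]
  -- gradient bound on the ball `B(y, r)`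
  have hVd : Differentiable ℝ V := hV.differentiable one_ne_zero
  have hGball : ∀ y' ∈ ball y r, ‖fderiv ℝ V y'‖ ≤ G := by
    intro y' hy'
    have h := aux_grad_ball hgrad hKKp hKp0 hqq' hq'0 (y := y) (r := r) (by rw [← hs]; linarith) y' hy'
    rw [← hs] at h
    rw [hG_def]
    linarith only [h, hκ]
  -- kernel data: base `s − r/4`, height = radius `r/2`, threshold `κ/2`, budgets `𝓔`, `𝓐`, disc radius `δ`
  have hs₀0 : 0 < s - r / 4 := by linarith
  have hh0 : 0 < r / 2 := by positivity
  have hκk0 : 0 < κ / 2 := by positivity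
  have h3s : 0 < 3 * s := by positivity
  have h𝓔0 : 0 < (3 * s) ^ (1 - ρ) * C₁ := by positivity
  have h𝓐0 : 0 < (c : ℝ) * (3 * s) ^ (1 - 2 * ρ) + 1 := by positivity
  obtain ⟨D, hD_def⟩ : ∃ D : ℝ,
      D = 32 * ((c : ℝ) * (3 * s) ^ (1 - 2 * ρ) + 1) / ((κ / 2) ^ 2 * (s - r / 4) ^ 2 * (r / 2)) / π :=
    ⟨_, rfl⟩
  have hD0 : 0 < D := by rw [hD_def]; positivity
  obtain ⟨δ, hδ_def⟩ : ∃ δ : ℝ, δ = Real.sqrt ((r / 2) ^ 2 + D) := ⟨_, rfl⟩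
  have hδsq : δ ^ 2 = (r / 2) ^ 2 + D := by rw [hδ_def]; exact Real.sq_sqrt (by positivity)
  have hδ0 : 0 ≤ δ := by rw [hδ_def]; exact Real.sqrt_nonneg _
  have hwδ : r / 2 < δ := by
    rw [hδ_def, Real.lt_sqrt hh0.le]
    linarith only [hD0]
  have hbudget : 32 * ((c : ℝ) * (3 * s) ^ (1 - 2 * ρ) + 1) / ((κ / 2) ^ 2 * (s - r / 4) ^ 2 * (r / 2)) ≤
      π * (δ ^ 2 - (r / 2) ^ 2) := by
    rw [hδsq, add_sub_cancel_left, hD_def, mul_div_cancel₀ _ Real.pi_pos.ne']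
  -- the ball budgets at radius `R = 3s`
  have hEball : ∫⁻ y in ball (0 : EuclideanSpace ℝ (Fin 3)) (3 * s), ‖fderiv ℝ V y‖ₑ ^ 2 ≤
      ENNReal.ofReal ((3 * s) ^ (1 - ρ) * C₁) := by
    refine (NeedleThinCore.lintegral_ball_fderiv_sq_le_of_opWeight hρ1 hE h3s).trans ?_
    rw [← ENNReal.ofReal_mul (by positivity)]
    exact ENNReal.ofReal_le_ofReal (mul_le_mul_of_nonneg_left hCC₁ (by positivity))
  have hAball : ∫⁻ y in ball (0 : EuclideanSpace ℝ (Fin 3)) (3 * s), ‖V y‖ₑ ^ 2 ≤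
      ENNReal.ofReal ((c : ℝ) * (3 * s) ^ (1 - 2 * ρ) + 1) := by
    refine (hA (3 * s) h3s).trans ?_
    rw [← ENNReal.ofReal_coe_nnreal, ← ENNReal.ofReal_mul (NNReal.coe_nonneg c)]
    exact ENNReal.ofReal_le_ofReal (le_add_of_nonneg_right zero_le_one)
  -- the cylinder and its disc fit in `B(0, 3s)`
  have hD7 : D ≤ 7 * s ^ 2 := by
    rw [hD_def]
    exact aux_budget_le hs1 hκ (NNReal.coe_nonneg c) hρ.le hq'3 hr0 hrs hκs hsA
  have hR : (s - r / 4 + r / 2) ^ 2 + δ ^ 2 ≤ (3 * s) ^ 2 := aux_fit hs0.le hr0.le hrs hD7 hδsq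
  -- the core hypothesis on the short cylinder
  have hcore : ∀ t ∈ Ioo (s - r / 4) (s - r / 4 + r / 2), ∀ z : ℂ, ‖z‖ ≤ r / 2 →
      κ / 2 * (s - r / 4) ≤ -⟪e, V (discChart (t • e) e₁ e₂ z)⟫ := by
    intro t ht z hz
    have hmem : discChart (t • e) e₁ e₂ z ∈ ball (s • e) r := discChart_mem_ball_of_short hon hr0 ht hz
    rw [← hye] at hmem
    have hin := inflow_on_ball hVd he hfast hGball hGr.le hr0 hmem
    have : κ * (s - r / 4) ≤ κ * s := mul_le_mul_of_nonneg_left (by linarith) hκ.le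
    linarith only [hin, this]
  -- THE KERNEL
  have hker := needle_inradius_le_radial (V' := fderiv ℝ V) (fun y => (hVd y).hasFDerivAt)
    (hV.continuous_fderiv one_ne_zero) hon hs₀0 hh0 hh0 hwδ hκk0 h3s hR h𝓔0 h𝓐0 hEball hAball hbudget hcore
  -- the exponent dominates `B₀ s^θ`
  have hX : B₀ * s ^ (2 + ρ - q') ≤
      π * (κ / 2 * (s - r / 4)) ^ 2 * (r / 2) / (16 * ((3 * s) ^ (1 - ρ) * C₁)) := by
    rw [hB₀]
    exact aux_exponent_ge hs1 hκ hM0 hC₁0 hρ.le hr0 hrs hκs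
  -- `r/2 ≤ δ e^{−X} ≤ 3 s e^{−B₀ s^θ}`
  have hδ3 : δ ≤ 3 * s := by
    have : δ ^ 2 ≤ (3 * s) ^ 2 := by linarith only [hR, sq_nonneg (s - r / 4 + r / 2)]
    exact (pow_le_pow_iff_left₀ hδ0 (by positivity) two_ne_zero).1 this
  have hw3 : r / 2 ≤ 3 * s * Real.exp (-(B₀ * s ^ (2 + ρ - q'))) := by
    calc r / 2 ≤ δ * Real.exp (-(π * (κ / 2 * (s - r / 4)) ^ 2 * (r / 2) / (16 * ((3 * s) ^ (1 - ρ) * C₁)))) :=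
          hker
      _ ≤ δ * Real.exp (-(B₀ * s ^ (2 + ρ - q'))) :=
          mul_le_mul_of_nonneg_left (Real.exp_le_exp.2 (neg_le_neg hX)) hδ0
      _ ≤ 3 * s * Real.exp (-(B₀ * s ^ (2 + ρ - q'))) := mul_le_mul_of_nonneg_right hδ3 (Real.exp_pos _).le
  -- contradiction with «exponential beats power»
  exact aux_contra hs0 hκ hM0.le hsq0.le hκs hw3 hev_s

/-! ## The member corollary -/

/-- **SUB-`(2+ρ)` GRADIENT GROWTH IS TAME (member level).**  Under the crux hypotheses verbatim (suitable weak Euler solution on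
`ℝ³ × (−∞,0)` with weak spatial gradient `H` and the three power gauges `a^{2ρ}A + a^ρ E + a^{2ρ}D ≤ c`), exact self-similarity
`u(τ) = (−τ)^{γ−1} V((−τ)^{−γ} ·)`, `p(τ) = (−τ)^{2γ−2} P((−τ)^{−γ} ·)`, `γ = 1/(2+ρ)`, in the window `0 < ρ ≤ 1/2`, a `C²` velocity
profile with POLYNOMIAL GRADIENT GROWTH `‖∇V(y)‖ ≤ K(1+‖y‖)^q`, `q < 2+ρ`, the member is trivial: `radialBarrier_of_polyGradient`
(with the inputs `NeedleThinCore.selfSimilar_needle_inputs`) produces the one-sided radial barrier with `κ = γ/2 < γ`, and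
`Loc.selfSimilar_ae_eq_zero_of_radialInflowC2_profile` kills.  Widens `IsTameC2Profile`'s «uniformly continuous» disjunct.
[folklore] -/
theorem selfSimilar_ae_eq_zero_of_polyGradient {ρ : ℝ} (hρ : 0 < ρ) (hρh : ρ ≤ 1 / 2)
    {u : ℝ → EuclideanSpace ℝ (Fin 3) → EuclideanSpace ℝ (Fin 3)} {p : ℝ → EuclideanSpace ℝ (Fin 3) → ℝ}
    {H : ℝ → EuclideanSpace ℝ (Fin 3) → EuclideanSpace ℝ (Fin 3) →L[ℝ] EuclideanSpace ℝ (Fin 3)} {c : ℝ≥0}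
    (hsw : IsSuitableWeakSolutionOn (slab (EuclideanSpace ℝ (Fin 3)) (Iio 0) isOpen_Iio) 0 0 u p)
    (hH : HasWeakSpatialGradientOn (slab (EuclideanSpace ℝ (Fin 3)) (Iio 0) isOpen_Iio) u H)
    (hgauge : ∀ a : ℝ, 0 < a →
      ENNReal.ofReal (a ^ (2 * ρ)) * cknA a (0 : ℝ × EuclideanSpace ℝ (Fin 3)) u +
          ENNReal.ofReal (a ^ ρ) * cknE a (0 : ℝ × EuclideanSpace ℝ (Fin 3)) H +
        ENNReal.ofReal (a ^ (2 * ρ)) * cknD a (0 : ℝ × EuclideanSpace ℝ (Fin 3)) p ≤ (c : ℝ≥0∞))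
    {V : EuclideanSpace ℝ (Fin 3) → EuclideanSpace ℝ (Fin 3)} {P : EuclideanSpace ℝ (Fin 3) → ℝ}
    (hu : ∀ τ : ℝ, τ < 0 → u τ = selfSimilarCollapse (1 / (2 + ρ)) 0 V τ)
    (hp : ∀ τ : ℝ, τ < 0 → p τ = selfSimilarCollapsePressure (1 / (2 + ρ)) 0 P τ)
    (hV : ContDiff ℝ 2 V) {K q : ℝ} (hq : q < 2 + ρ) (hgrad : ∀ y, ‖fderiv ℝ V y‖ ≤ K * (1 + ‖y‖) ^ q) :
    uncurry u =ᵐ[volume.restrict (Iio (0 : ℝ) ×ˢ (univ : Set (EuclideanSpace ℝ (Fin 3))))] 0 := by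
  have hρ1 : ρ < 1 := by linarith
  have hV1 : ContDiff ℝ 1 V := hV.of_le one_le_two
  obtain ⟨hA, hE⟩ := NeedleThinCore.selfSimilar_needle_inputs hρ hρ1 hsw hH hgauge hu hp hV1
  have h2ρ : (0 : ℝ) < 2 + ρ := by linarith
  have hγ : (0 : ℝ) < 1 / (2 + ρ) := one_div_pos.2 h2ρ
  obtain ⟨R₁, hR₁⟩ := radialBarrier_of_polyGradient hρ hρ1 hV1 hA hE hq hgrad (half_pos hγ)
  exact Loc.selfSimilar_ae_eq_zero_of_radialInflowC2_profile hρ hρh hsw hgauge hu hp hV (half_lt_self hγ) hR₁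

end Summit.NavierStokesRegularity.NavierStokesRegularity.Theorems.PowerGaugeEulerLiouville.NeedleGradientGrowth

end
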